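import Mathlib.Analysis.SpecialFunctions.Pow.Real
import Mathlib.Analysis.SpecialFunctions.Log.Basic
import Literature.Probability.LatticeModels.CorrelationDecay
import Literature.Probability.Percolation.FourArmGarban
import HarnessLib

/-!
# Two-arm versus one-arm: the polychromatic two-arm probability is polynomially smaller than
# the product of the one-arm probabilities (critical bond percolation on `ℤ²`)

Topic `Literature/Probability/Percolation`; bond percolation on the square lattice `ℤ² = Site 2` at
`p = 1/2` (`bondPercolation (zdGraph 2) half`), over the annulus vocabulary of `FourArmGarban.lean`
(`sqAnnulus m n = {m ≤ ‖v‖_∞ ≤ n}`, `siteSphere`, `sqAnnulusOpenCrossing`, `openCircuitInAnnulus`,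
`twoArmOpenDual`).

## The result

For the one-arm events `A₁(r,R)` (an open = primal arm across the annulus `Ann(r,R) = Λ_R ∖ Λ_r`,
`Λ_n = [-n,n]² ∩ ℤ²`), `A₀(r,R)` (a closed dual arm across it) and the polychromatic two-arm event
`A₀₁(r,R) = A₀(r,R) ∩ A₁(r,R)`, the Harris–FKG inequality gives `P[A₀₁] ≤ P[A₁] P[A₀]`
(`A₁` increasing, `A₀` decreasing). The theorem vendored here is the polynomial improvement

  `P_{1/2}[A₀₁(r,R)] ≤ (r/R)^c · P_{1/2}[A₁(r,R)] · P_{1/2}[A₀(r,R)]`  for `R/r` large,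

i.e. "the two-arm exponent is strictly larger than the sum (= twice, by self-duality) of the
one-arm exponents", `α₀₁ > α₀ + α₁`, whenever these exponents exist (proved corollary
`GassmannManolescu2025_twoArmOneArm.exponent_gap` below). Two independent and simultaneous proofs
(both arXiv'd 30 Oct 2024):

* L. Gassmann, I. Manolescu, *Comparison of arm exponents in planar FK-percolation*, ALEA Lat. Am.
  J. Probab. Math. Stat. 22 (2025), 1053–1065 = arXiv:2410.23013 [GassmannManolescu2025],
  **Theorem 1.1** (held text `paper:arxiv-2410.23013`, chunk 3), verbatim: "Fix `1 ≤ q ≤ 4`. There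
  exists `c > 0` such that for every `r ≤ R` with `R/r` large enough,
  `φ_{p_c,q}[A₀₁(r,R)] ≤ (r/R)^c φ_{p_c,q}[A₁(r,R)] φ_{p_c,q}[A₀(r,R)]`", for the critical
  infinite-volume FK measure on `ℤ²`; at `q = 1`, `p_c(1) = 1/2`, this is Bernoulli bond
  percolation on `ℤ²` (ibid. §1: "For `q = 1` the bias disappears, and we recover the Bernoulli
  percolation model"). Their events (§1, verbatim): "We denote by `Λ_n` the subgraph of `ℤ²`
  induced by the vertex set `{-n,…,n}²` and by `∂Λ_n` its vertex boundary. For `0 < r < R`, let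
  `Ann(r,R)` denote the annulus `Λ_R ∖ Λ_r`. For `1 ≤ r < R`, we denote by `A₁(r,R)` (resp.
  `A₀(r,R)`) the event that the inner and outer boundaries of `Ann(r,R)` are connected by an arm of
  type `1` (resp. type `0`). Additionally, denote by `A₀₁(r,R)` the event that the inner and outer
  boundaries of the annulus `Ann(r,R)` are connected by both an arm of type `0` and an arm of type
  `1`." ("An arm of type `1` (resp. type `0`) is a path formed of primal open (resp. dual open)
  edges.")
* R. R. Radhakrishnan, V. Tassion, *Strict inequalities for arm exponents in planar percolation*,
  Probab. Theory Related Fields 195 (2025), 659–688 = arXiv:2410.23250 [RadhakrishnanTassion2025],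
  **Theorem 1** (held text `paper:arxiv-2410.23250`, chunk 3): "There exists `c > 0` such that for
  all `n ≥ 10` we have `P[A_n(b) ∩ A_n(w)] ≤ n^{-c} · P[A_n(b)] P[A_n(w)]`", printed for critical
  face percolation on the hexagonal lattice with arms from the hexagon at `0` to `∂[-n,n]²`, and
  **Remark 2**: "our method also applies to critical bond percolation on the square lattice, where
  the analogue of Theorem 1 is new" (abstract: "apply it to arm estimates for Bernoulli bond
  percolation on `ℤ²`. Our first result is that the two-arm exponent is strictly larger than
  twice the one-arm exponent"). This answers a question of Garban–Steif (noise-sensitivity book,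
  2014) motivated by exceptional times of dynamical percolation.

ONE named fact is vendored, `GassmannManolescu2025_twoArmOneArm`: the annulus statement of
Gassmann–Manolescu's Theorem 1.1 at `q = 1` (the form with a complete printed proof for `ℤ²`; the
from-the-origin form of Radhakrishnan–Tassion is its specialisation to a fixed inner radius, up to
the constants), cited to both papers; plus two PROVED consequences taking it as a hypothesis:
`.sphere_indexed` (the same bound in the `m = r + 1 ≤ n` sphere indexing of `FourArmGarban.lean`)
and `.exponent_gap` (`α₀ + α₁ < α₀₁` when the exponents exist).

## Rendering (the dictionary of `FourArmGarban.lean`)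

* `Ann(r,R) = Λ_R ∖ Λ_r` has vertex set `{r+1 ≤ ‖v‖_∞ ≤ R} = sqAnnulus (r+1) R`; its inner
  boundary is `siteSphere (r+1)`, its outer boundary `siteSphere R`. An open path of `ℤ²` joining
  the two boundary spheres contains a sub-path joining them inside the annulus (sup-norms change
  by `≤ 1` along lattice edges), so `A₁(r,R) = sqAnnulusOpenCrossing (r+1) R` exactly.
* Planar duality on the self-dual square lattice (Kesten 1982, §2; Grimmett 1999, §11): a closed
  dual arm crosses the annulus iff NO open circuit of the annulus surrounds the origin, so the dual
  one-arm event is rendered duality-free as the complement `(openCircuitInAnnulus (r+1) R)ᶜ`, and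
  `A₀₁(r,R) = A₁ ∩ A₀ = twoArmOpenDual (r+1) R` (`= sqAnnulusOpenCrossing ∖ openCircuitInAnnulus`,
  the event already used for `π₂` in `Garban2011_fourArm_multiscale`).
* Boundary conventions. Where exactly a dual arm starts and ends (dual radius `r + 1/2` versus
  `r + 3/2`, `R - 1/2` versus `R + 1/2`) is not fixed by the printed sentence; the complement form
  above corresponds to dual arms from dual radius `r + 1/2` to dual radius `R + 1/2`. Any two such
  conventions change each of the three probabilities by factors bounded above and below uniformly
  in `r ≤ R` (Russo–Seymour–Welsh gluing at `p = 1/2`), and a bounded factor `K` is absorbed by the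
  statement's shape: `P₀₁ ≤ K (r/R)^c P₁ P₀ ≤ (r/R)^{c/2} P₁ P₀` once `R/r ≥ K^{2/c}`. So the
  rendering neither strengthens nor weakens the printed theorem beyond the (unspecified) values of
  `c` and of the threshold on `R/r`.
* "for every `r ≤ R` with `R/r` large enough" is `∃ L, ∀ r R, 1 ≤ r → L * r ≤ R → …`
  (`r ≥ 1` as in the source, "For `1 ≤ r < R`"). Degenerate instances the witness `L` may avoid
  anyway are harmless: for `R ≤ r` the annulus is empty, the left side is `0` and the right side is
  `≥ 0`.
* The measure is the infinite-volume product measure `bondPercolation (zdGraph 2) half`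
  (= `φ_{p_c(1),1}`); probabilities are `μ.real`; `(r/R)^c` is the real power `Real.rpow`.

## Deliberately NOT here

* The hexagonal-lattice / triangular-site-percolation statement (Radhakrishnan–Tassion, Thm. 1 as
  printed): there it follows from the known exponents `α₁ = 5/48` (Lawler–Schramm–Werner 2002) and
  `α₂ = 1/4` (Smirnov–Werner 2001), `1/4 > 2 · 5/48`, which the tree records in
  `ArmExponents.lean` / `ArmExponentsTwoArm.lean` (RT, Remark 2: "As stated, Theorem 1 is not new").
* FK percolation `1 < q ≤ 4` (Gassmann–Manolescu's full Theorem 1.1): the tree's random-cluster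
  vocabulary is not imported here; only `q = 1` is rendered (see the `TODO(general form)` line).
* Radhakrishnan–Tassion's Theorem 2 (monochromatic versus polychromatic two arms, after
  Beffara–Nolin 2011) and their quantitative Harris–FKG / Reimer identities (Props. 1–2).
* Positivity `P[A₀₁(r,R)] > 0` and the existence of the exponents: hypotheses of the corollary,
  not consequences of the fact.

Mathlib search: no percolation / arm events in Mathlib (`rg -i "arm event|percolation"` in Mathlib:
nothing relevant); `Real.rpow`, `Real.log`, `Filter.Tendsto`, `MeasureTheory.measureReal_nonneg`
from Mathlib; `HasDecayExponent` from `CorrelationDecay.lean`.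
-/

noncomputable section

open MeasureTheory Filter
open scoped Topology

namespace Literature.Probability.Percolation

open LatticeModels

/-- **Two-arm versus one-arm on `ℤ²`** (Gassmann–Manolescu 2025, Thm. 1.1 at `q = 1`;
Radhakrishnan–Tassion 2025, Thm. 1 with Remark 2 — "our method also applies to critical bond
percolation on the square lattice, where the analogue of Theorem 1 is new"). For critical bond
percolation on `ℤ²` (`p = 1/2`) there is `c > 0` such that for all `1 ≤ r ≤ R` with `R/r` large
enough,
`P[A₀₁(r,R)] ≤ (r/R)^c · P[A₁(r,R)] · P[A₀(r,R)]`,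
where, on the annulus `Ann(r,R) = Λ_R ∖ Λ_r = {r+1 ≤ ‖v‖_∞ ≤ R}`, `A₁` = an open arm joins the inner
and outer boundary (`sqAnnulusOpenCrossing (r+1) R`), `A₀` = a closed dual arm does, rendered
duality-free as "no open circuit of the annulus surrounds the origin"
(`(openCircuitInAnnulus (r+1) R)ᶜ`), and `A₀₁ = A₁ ∩ A₀ = twoArmOpenDual (r+1) R`; see the module
docstring for the dictionary and why boundary conventions only move `c` and the threshold. A
polynomial improvement of Harris–FKG (`P[A₀₁] ≤ P[A₁] P[A₀]`); in exponent language
`α₀₁ > α₀ + α₁ (= 2α₁)`, see `GassmannManolescu2025_twoArmOneArm.exponent_gap`.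
[cite: GassmannManolescu2025, Thm. 1.1 (q = 1)] [cite: RadhakrishnanTassion2025, Thm. 1 and Remark 2] -/
def GassmannManolescu2025_twoArmOneArm : Prop :=
  ∃ c : ℝ, 0 < c ∧ ∃ L : ℕ, ∀ r R : ℕ, 1 ≤ r → L * r ≤ R →
    (bondPercolation (zdGraph 2) half).real (twoArmOpenDual (r + 1) R) ≤
      ((r : ℝ) / R) ^ c *
        ((bondPercolation (zdGraph 2) half).real (sqAnnulusOpenCrossing (r + 1) R) *
          (bondPercolation (zdGraph 2) half).real (openCircuitInAnnulus (r + 1) R)ᶜ)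

-- TODO(general form): Gassmann–Manolescu's Theorem 1.1 is printed for the critical FK
-- (random-cluster) measure `φ_{p_c(q),q}` on `ℤ²` for every `1 ≤ q ≤ 4`; only `q = 1` is rendered.

/-- **Sphere-indexed form** of `GassmannManolescu2025_twoArmOneArm`, in the indexing of
`FourArmGarban.lean` (`Garban2011_fourArm_multiscale`: annuli `{m ≤ ‖v‖_∞ ≤ n}` named by the norms
`m ≤ n` of their boundary spheres, i.e. `m = r + 1`): there are `c > 0` and `L` such that
`P[twoArmOpenDual m n] ≤ (m/n)^c · P[sqAnnulusOpenCrossing m n] · P[(openCircuitInAnnulus m n)ᶜ]`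
for all `2 ≤ m` and `L m ≤ n`. Immediate from the fact with `r = m - 1`, since
`((m-1)/n)^c ≤ (m/n)^c`. [cite: GassmannManolescu2025, Thm. 1.1 (q = 1)] -/
theorem GassmannManolescu2025_twoArmOneArm.sphere_indexed
    (h : GassmannManolescu2025_twoArmOneArm) :
    ∃ c : ℝ, 0 < c ∧ ∃ L : ℕ, ∀ m n : ℕ, 2 ≤ m → L * m ≤ n →
      (bondPercolation (zdGraph 2) half).real (twoArmOpenDual m n) ≤
        ((m : ℝ) / n) ^ c *
          ((bondPercolation (zdGraph 2) half).real (sqAnnulusOpenCrossing m n) *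
            (bondPercolation (zdGraph 2) half).real (openCircuitInAnnulus m n)ᶜ) := by
  obtain ⟨c, hc, L, hL⟩ := h
  refine ⟨c, hc, L, fun m n hm hLm => ?_⟩
  obtain ⟨r, rfl⟩ : ∃ r, m = r + 1 := ⟨m - 1, by omega⟩
  have hr : 1 ≤ r := by omega
  have hLr : L * r ≤ n := le_trans (Nat.mul_le_mul_left L (Nat.le_succ r)) hLm
  refine (hL r n hr hLr).trans (mul_le_mul_of_nonneg_right ?_ ?_)
  · refine Real.rpow_le_rpow (by positivity) ?_ hc.le
    exact div_le_div_of_nonneg_right (by exact_mod_cast Nat.le_succ r) (Nat.cast_nonneg n)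
  · exact mul_nonneg measureReal_nonneg measureReal_nonneg

/-- **The strict inequality between exponents** (Gassmann–Manolescu 2025, §1, the display
following Thm. 1.1: "Assuming the existence of these exponents, inequality [of Thm. 1.1] may be
rewritten as `α₀₁ > α₀ + α₁`"; Radhakrishnan–Tassion 2025, abstract: "the two-arm exponent is
strictly larger than twice the one-arm exponent"). If, for a fixed inner radius `r ≥ 1`, the
two-arm probabilities `P[A₀₁(r,R)]` are eventually positive and the three sequences
`R ↦ P[A₀₁(r,R)]`, `P[A₁(r,R)]`, `P[A₀(r,R)]` have logarithmic decay exponents `α₀₁`, `α₁`, `α₀`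
(`HasDecayExponent`: `log P / log R → -α`), then the fact gives `α₀ + α₁ < α₀₁`. Proof: take
logarithms in `P₀₁ ≤ (r/R)^c P₁ P₀`, divide by `log R` and pass to the limit
(`-α₀₁ ≤ -c - α₁ - α₀`). Positivity and the existence of the exponents are hypotheses, as in the
source ("if the alternating two-arm exponent `α₀₁` and the one-arm exponents `α₀` and `α₁` exist,
then they satisfy the strict inequality `α₀₁ > α₀ + α₁`", abstract).
[cite: GassmannManolescu2025, Thm. 1.1 and the display following it (§1)] -/
theorem GassmannManolescu2025_twoArmOneArm.exponent_gap
    (h : GassmannManolescu2025_twoArmOneArm) {r : ℕ} (hr : 1 ≤ r) {α₀₁ α₁ α₀ : ℝ}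
    (hpos : ∀ᶠ R : ℕ in atTop,
      0 < (bondPercolation (zdGraph 2) half).real (twoArmOpenDual (r + 1) R))
    (h₀₁ : HasDecayExponent
      (fun R => (bondPercolation (zdGraph 2) half).real (twoArmOpenDual (r + 1) R)) α₀₁)
    (h₁ : HasDecayExponent
      (fun R => (bondPercolation (zdGraph 2) half).real (sqAnnulusOpenCrossing (r + 1) R)) α₁)
    (h₀ : HasDecayExponent
      (fun R => (bondPercolation (zdGraph 2) half).real (openCircuitInAnnulus (r + 1) R)ᶜ) α₀) :
    α₀ + α₁ < α₀₁ := by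
  obtain ⟨c, hc, L, hL⟩ := h
  set μ := bondPercolation (zdGraph 2) half with hμ
  -- Notation for the three sequences.
  set P₀₁ : ℕ → ℝ := fun R => μ.real (twoArmOpenDual (r + 1) R) with hP₀₁
  set P₁ : ℕ → ℝ := fun R => μ.real (sqAnnulusOpenCrossing (r + 1) R) with hP₁
  set P₀ : ℕ → ℝ := fun R => μ.real (openCircuitInAnnulus (r + 1) R)ᶜ with hP₀
  have hr0 : (0 : ℝ) < r := by exact_mod_cast hr
  -- `log R → ∞` along the naturals, hence `log r / log R → 0`.
  have hlog : Tendsto (fun R : ℕ => Real.log (R : ℝ)) atTop atTop :=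
    Real.tendsto_log_atTop.comp tendsto_natCast_atTop_atTop
  have hconst : Tendsto (fun R : ℕ => Real.log (r : ℝ) / Real.log (R : ℝ)) atTop (𝓝 0) :=
    tendsto_const_nhds.div_atTop hlog
  -- The right-hand side after taking logarithms and dividing by `log R`.
  have hrhs : Tendsto (fun R : ℕ => c * (Real.log (r : ℝ) / Real.log (R : ℝ) - 1) +
      Real.log (P₁ R) / Real.log (R : ℝ) + Real.log (P₀ R) / Real.log (R : ℝ)) atTop
      (𝓝 (c * (0 - 1) + -α₁ + -α₀)) :=
    (((hconst.sub_const 1).const_mul c).add h₁).add h₀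
  -- Eventually, the fact gives the pointwise inequality between the two sequences.
  have hev : ∀ᶠ R : ℕ in atTop, Real.log (P₀₁ R) / Real.log (R : ℝ) ≤
      c * (Real.log (r : ℝ) / Real.log (R : ℝ) - 1) +
        Real.log (P₁ R) / Real.log (R : ℝ) + Real.log (P₀ R) / Real.log (R : ℝ) := by
    filter_upwards [hpos, eventually_ge_atTop (L * r), eventually_ge_atTop 2] with R hposR hLR hR2
    have hR0 : (0 : ℝ) < R := by exact_mod_cast (lt_of_lt_of_le (by norm_num) hR2 : 0 < R)
    have hlogR : 0 < Real.log (R : ℝ) := Real.log_pos (by exact_mod_cast hR2)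
    have hineq : P₀₁ R ≤ ((r : ℝ) / R) ^ c * (P₁ R * P₀ R) := hL r R hr hLR
    have hrpow_pos : 0 < ((r : ℝ) / R) ^ c := Real.rpow_pos_of_pos (div_pos hr0 hR0) c
    have hP₁nn : 0 ≤ P₁ R := measureReal_nonneg
    have hP₀nn : 0 ≤ P₀ R := measureReal_nonneg
    -- positivity of `P₁ R` and `P₀ R` follows from that of `P₀₁ R`
    have hprod_pos : 0 < P₁ R * P₀ R := by
      by_contra hcon
      have hle : P₁ R * P₀ R ≤ 0 := not_lt.mp hcon
      have : P₀₁ R ≤ 0 := hineq.trans (by nlinarith [hrpow_pos.le])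
      exact absurd hposR (not_lt.mpr this)
    have hP₁pos : 0 < P₁ R := by
      rcases hP₁nn.lt_or_eq with h | h
      · exact h
      · exact absurd hprod_pos (by rw [← h, zero_mul]; exact lt_irrefl 0)
    have hP₀pos : 0 < P₀ R := by
      rcases hP₀nn.lt_or_eq with h | h
      · exact h
      · exact absurd hprod_pos (by rw [← h, mul_zero]; exact lt_irrefl 0)
    -- take logarithms
    have hlogineq : Real.log (P₀₁ R) ≤
        c * (Real.log (r : ℝ) - Real.log (R : ℝ)) + Real.log (P₁ R) + Real.log (P₀ R) := by
      have h1 : Real.log (P₀₁ R) ≤ Real.log (((r : ℝ) / R) ^ c * (P₁ R * P₀ R)) :=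
        Real.log_le_log hposR hineq
      have h2 : Real.log (((r : ℝ) / R) ^ c * (P₁ R * P₀ R)) =
          c * (Real.log (r : ℝ) - Real.log (R : ℝ)) + Real.log (P₁ R) + Real.log (P₀ R) := by
        rw [Real.log_mul hrpow_pos.ne' hprod_pos.ne', Real.log_mul hP₁pos.ne' hP₀pos.ne',
          Real.log_rpow (div_pos hr0 hR0), Real.log_div hr0.ne' hR0.ne']
        ring
      exact h1.trans_eq h2
    -- divide by `log R > 0`
    have h3 : Real.log (P₀₁ R) / Real.log (R : ℝ) ≤
        (c * (Real.log (r : ℝ) - Real.log (R : ℝ)) + Real.log (P₁ R) + Real.log (P₀ R)) /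
          Real.log (R : ℝ) :=
      div_le_div_of_nonneg_right hlogineq hlogR.le
    have h4 : (c * (Real.log (r : ℝ) - Real.log (R : ℝ)) + Real.log (P₁ R) + Real.log (P₀ R)) /
          Real.log (R : ℝ) =
        c * (Real.log (r : ℝ) / Real.log (R : ℝ) - 1) +
          Real.log (P₁ R) / Real.log (R : ℝ) + Real.log (P₀ R) / Real.log (R : ℝ) := by
      field_simp
    exact h3.trans_eq h4
  have hlim := le_of_tendsto_of_tendsto h₀₁ hrhs hev
  linarith

end Literature.Probability.Percolation
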